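import Literature.MathematicalPhysics.KineticTheory.LangevinChainGibbs

/-!
# Exponential-moment growth of the Gibbs state of the pinned chain (controlled `N`-dependence)

STATUS (w-FSD, piece FS-D of stub `stub_lightConeWindow`, crux stmt-AtomisticToContinuum-9127):
(D1) PROVED here (clean), registered sub-goal `pinnedChain_gibbsExpMomentGrowth`; (D2) in `FSDFourthMoment*.lean`.

Helper (`--supports`) for the line `contact-current-forgetting` of the crux
`JunctionLocality.NonBallistic` (stmt-AtomisticToContinuum-9127), stub `stub_lightConeWindow` (LC),
piece FS-D (Gibbs STATICS with controlled `N`-dependence), part (D1): for the pinned anharmonic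
chain `P = pinnedChain ω₂ lam β γ` (`ω₂ > 0`, `lam, β ≥ 0`, any `γ`), `T > 0` and `ϑ < 1/T`,

  `∃ c, ∀ N, ∫ e^{ϑ H} dμ_T^N ≤ e^{c N}`,

where `μ_T^N = P.gibbsMeasure N T = Z⁻¹ e^{-H/T} dq dp`, together with the Chebyshev corollary
`μ_T^N {H > K N} ≤ e^{(c - ϑ K) N}` (`ϑ ≥ 0`).

Proof: `∫ e^{ϑH} dμ_T = (∫ e^{-H/T})⁻¹ ∫ e^{-(1/T - ϑ) H}` (`integral_gibbsMeasure`). Upper bound on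
the numerator: drop the nonnegative quartic and coupling terms, `H ≥ ∑ (p_i² + ω₂ q_i²)/2`
(`pinnedChain_harmonic_le_hamiltonian`), so the integrand is dominated by a product of `2N`
one-dimensional Gaussians, whose integral is `K₂^N` (Fubini on `PhaseSpace N = (Fin N → ℝ)²`,
`integral_fintype_prod_volume_eq_pow`). Lower bound on the denominator: the coupling is dominated
by on-site terms, `V(q_j - q_i) ≤ w(q_i) + w(q_j)` with `w(q) = q² + 2β q⁴`, and each site lies on
at most two bonds, so `H ≤ ∑ (p_i²/2 + U(q_i) + 2 w(q_i))` and `∫ e^{-H/T} ≥ K₁^N` with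
`K₁ = (∫ e^{-(U + 2w)/T}) (∫ e^{-a²/(2T)} da) > 0`. Hence the ratio is at most
`(K₂/K₁)^N = e^{cN}`, `c = log (K₂/K₁)`. Everything is elementary and tagged folklore.
-/

noncomputable section

open MeasureTheory Finset

namespace Summit.AtomisticToContinuum.FouriersLaw.Theorems.NonBallistic

open Literature.MathematicalPhysics.KineticTheory.HeatConduction

variable {ω₂ lam β : ℝ}

/-! ## Fubini for separable integrands on phase space -/

/-- `∫ (∏ f(q_i)) (∏ g(p_i)) dq dp = (∫ f)^N (∫ g)^N` on `PhaseSpace N = (Fin N → ℝ) × (Fin N → ℝ)`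
(no integrability needed: both sides vanish together). [folklore] -/
theorem integral_phaseSpace_prod_mul_prod (N : ℕ) (f g : ℝ → ℝ) :
    ∫ x : PhaseSpace N, (∏ i, f (x.1 i)) * ∏ i, g (x.2 i) = (∫ a, f a) ^ N * (∫ a, g a) ^ N := by
  have h := integral_prod_mul (μ := (volume : Measure (Fin N → ℝ)))
    (ν := (volume : Measure (Fin N → ℝ))) (fun q : Fin N → ℝ => ∏ i, f (q i))
    (fun p : Fin N → ℝ => ∏ i, g (p i))
  rw [integral_fintype_prod_volume_eq_pow, integral_fintype_prod_volume_eq_pow,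
    Fintype.card_fin] at h
  rw [← h, Measure.volume_eq_prod]

/-- A product of integrable one-dimensional factors is integrable on phase space. [folklore] -/
theorem integrable_phaseSpace_prod_mul_prod (N : ℕ) {f g : ℝ → ℝ} (hf : Integrable f)
    (hg : Integrable g) :
    Integrable fun x : PhaseSpace N => (∏ i, f (x.1 i)) * ∏ i, g (x.2 i) := by
  have hq : Integrable (fun q : Fin N → ℝ => ∏ i, f (q i)) := by
    have := Integrable.fintype_prod (μ := fun _ : Fin N => (volume : Measure ℝ))
      (f := fun _ t => f t) (fun _ => hf)
    simpa [volume_pi] using this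
  have hp : Integrable (fun p : Fin N → ℝ => ∏ i, g (p i)) := by
    have := Integrable.fintype_prod (μ := fun _ : Fin N => (volume : Measure ℝ))
      (f := fun _ t => g t) (fun _ => hg)
    simpa [volume_pi] using this
  have := hq.mul_prod hp
  simpa [Measure.volume_eq_prod] using this

/-! ## Pointwise bounds on the Gibbs weight by separable weights -/

/-- At most one `j : Fin N` has `j = i + 1`: `∑_j [j = i+1] c ≤ c` for `c ≥ 0`. [folklore] -/
theorem sum_ite_eq_succ_le {N : ℕ} (i : Fin N) {c : ℝ} (hc : 0 ≤ c) :
    (∑ j : Fin N, if j.val = i.val + 1 then c else 0) ≤ c := by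
  rw [Finset.sum_ite, Finset.sum_const_zero, add_zero, Finset.sum_const, nsmul_eq_mul]
  have hcard : ((Finset.univ.filter fun j : Fin N => j.val = i.val + 1).card : ℝ) ≤ 1 := by
    exact_mod_cast Finset.card_le_one.mpr fun a ha b hb => Fin.ext (by
      simp only [Finset.mem_filter] at ha hb; omega)
  nlinarith

/-- At most one `i : Fin N` has `j = i + 1`: `∑_i [j = i+1] c ≤ c` for `c ≥ 0`. [folklore] -/
theorem sum_ite_eq_pred_le {N : ℕ} (j : Fin N) {c : ℝ} (hc : 0 ≤ c) :
    (∑ i : Fin N, if j.val = i.val + 1 then c else 0) ≤ c := by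
  rw [Finset.sum_ite, Finset.sum_const_zero, add_zero, Finset.sum_const, nsmul_eq_mul]
  have hcard : ((Finset.univ.filter fun i : Fin N => j.val = i.val + 1).card : ℝ) ≤ 1 := by
    exact_mod_cast Finset.card_le_one.mpr fun a ha b hb => Fin.ext (by
      simp only [Finset.mem_filter] at ha hb; omega)
  nlinarith

/-- The FPU-`β` coupling across a bond is dominated by on-site terms at its two ends:
`V(b - a) ≤ w(a) + w(b)` with `w(q) = q² + 2β q⁴` (`β ≥ 0`). [folklore] -/
theorem pinnedChain_V_sub_le (hβ : 0 ≤ β) (ω₂ lam γ a b : ℝ) :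
    (pinnedChain ω₂ lam β γ).V (b - a) ≤ (a ^ 2 + 2 * β * a ^ 4) + (b ^ 2 + 2 * β * b ^ 4) := by
  show (b - a) ^ 2 / 2 + β * (b - a) ^ 4 / 4 ≤ (a ^ 2 + 2 * β * a ^ 4) + (b ^ 2 + 2 * β * b ^ 4)
  have h1 : (b - a) ^ 2 ≤ 2 * (a ^ 2 + b ^ 2) := by nlinarith [sq_nonneg (a + b)]
  have h2 : (b - a) ^ 4 ≤ 8 * (a ^ 4 + b ^ 4) := by
    have h3 : (b - a) ^ 2 * (b - a) ^ 2 ≤ (2 * (a ^ 2 + b ^ 2)) * (2 * (a ^ 2 + b ^ 2)) :=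
      mul_le_mul h1 h1 (sq_nonneg _) (by positivity)
    nlinarith [sq_nonneg (a ^ 2 - b ^ 2)]
  nlinarith [mul_le_mul_of_nonneg_left h2 hβ]

/-- **Separable upper bound on the energy.** Each site lies on at most two bonds, so
`H(q,p) ≤ ∑_i (p_i²/2 + U(q_i) + 2 w(q_i))`, `w(q) = q² + 2βq⁴` (`β ≥ 0`). [folklore] -/
theorem pinnedChain_hamiltonian_le_separable (hβ : 0 ≤ β) (ω₂ lam γ : ℝ) (N : ℕ)
    (x : PhaseSpace N) :
    (pinnedChain ω₂ lam β γ).hamiltonian N x ≤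
      ∑ i, (x.2 i ^ 2 / 2 + ((pinnedChain ω₂ lam β γ).U (x.1 i) +
        2 * (x.1 i ^ 2 + 2 * β * x.1 i ^ 4))) := by
  set w : ℝ → ℝ := fun q => q ^ 2 + 2 * β * q ^ 4 with hw
  have hw0 : ∀ q, 0 ≤ w q := fun q => by simp only [hw]; positivity
  have hbond : (∑ i : Fin N, ∑ j : Fin N,
      (if j.val = i.val + 1 then (pinnedChain ω₂ lam β γ).V (x.1 j - x.1 i) else 0)) ≤
      ∑ i : Fin N, 2 * w (x.1 i) := by
    calc (∑ i : Fin N, ∑ j : Fin N,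
          (if j.val = i.val + 1 then (pinnedChain ω₂ lam β γ).V (x.1 j - x.1 i) else 0))
        ≤ ∑ i : Fin N, ∑ j : Fin N, ((if j.val = i.val + 1 then w (x.1 i) else 0) +
            (if j.val = i.val + 1 then w (x.1 j) else 0)) := by
          refine Finset.sum_le_sum fun i _ => Finset.sum_le_sum fun j _ => ?_
          split_ifs
          · exact pinnedChain_V_sub_le hβ ω₂ lam γ (x.1 i) (x.1 j)
          · simp
      _ = (∑ i : Fin N, ∑ j : Fin N, (if j.val = i.val + 1 then w (x.1 i) else 0)) +
            ∑ i : Fin N, ∑ j : Fin N, (if j.val = i.val + 1 then w (x.1 j) else 0) := by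
          rw [← Finset.sum_add_distrib]
          exact Finset.sum_congr rfl fun i _ => Finset.sum_add_distrib
      _ = (∑ i : Fin N, ∑ j : Fin N, (if j.val = i.val + 1 then w (x.1 i) else 0)) +
            ∑ j : Fin N, ∑ i : Fin N, (if j.val = i.val + 1 then w (x.1 j) else 0) := by
          congr 1
          exact Finset.sum_comm
      _ ≤ (∑ i : Fin N, w (x.1 i)) + ∑ j : Fin N, w (x.1 j) :=
          add_le_add (Finset.sum_le_sum fun i _ => sum_ite_eq_succ_le i (hw0 _))
            (Finset.sum_le_sum fun j _ => sum_ite_eq_pred_le j (hw0 _))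
      _ = ∑ i : Fin N, 2 * w (x.1 i) := by rw [← Finset.sum_add_distrib]; simp [two_mul]
  unfold OscillatorChain.hamiltonian
  calc (∑ i, (x.2 i ^ 2 / 2 + (pinnedChain ω₂ lam β γ).U (x.1 i))) +
        ∑ i : Fin N, ∑ j : Fin N,
          (if j.val = i.val + 1 then (pinnedChain ω₂ lam β γ).V (x.1 j - x.1 i) else 0)
      ≤ (∑ i, (x.2 i ^ 2 / 2 + (pinnedChain ω₂ lam β γ).U (x.1 i))) + ∑ i : Fin N, 2 * w (x.1 i) :=
        add_le_add le_rfl hbond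
    _ = _ := by
        rw [← Finset.sum_add_distrib]
        refine Finset.sum_congr rfl fun i _ => ?_
        simp only [hw]
        ring

/-- **Separable lower bound on the Gibbs weight**:
`∏_i e^{-(U(q_i) + 2w(q_i))/T} ∏_i e^{-p_i²/(2T)} ≤ e^{-H/T}` (`β ≥ 0`, `T ≥ 0`). [folklore] -/
theorem pinnedChain_prod_le_gibbsDensity (hβ : 0 ≤ β) (ω₂ lam γ : ℝ) (N : ℕ) {T : ℝ} (hT : 0 ≤ T)
    (x : PhaseSpace N) :
    (∏ i, Real.exp (-((pinnedChain ω₂ lam β γ).U (x.1 i) + 2 * (x.1 i ^ 2 + 2 * β * x.1 i ^ 4)) / T)) *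
        ∏ i, Real.exp (-(x.2 i ^ 2 / 2) / T) ≤
      (pinnedChain ω₂ lam β γ).gibbsDensity N T x := by
  have hle := pinnedChain_hamiltonian_le_separable hβ ω₂ lam γ N x
  have e : (∏ i, Real.exp (-((pinnedChain ω₂ lam β γ).U (x.1 i) +
      2 * (x.1 i ^ 2 + 2 * β * x.1 i ^ 4)) / T)) * ∏ i, Real.exp (-(x.2 i ^ 2 / 2) / T) =
      Real.exp (-(∑ i, (x.2 i ^ 2 / 2 + ((pinnedChain ω₂ lam β γ).U (x.1 i) +
        2 * (x.1 i ^ 2 + 2 * β * x.1 i ^ 4)))) / T) := by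
    rw [← Real.exp_sum, ← Real.exp_sum, ← Real.exp_add]
    congr 1
    rw [← Finset.sum_add_distrib, neg_div, Finset.sum_div, ← Finset.sum_neg_distrib]
    refine Finset.sum_congr rfl fun i _ => ?_
    ring
  rw [e, OscillatorChain.gibbsDensity]
  exact Real.exp_le_exp.mpr (div_le_div_of_nonneg_right (neg_le_neg hle) hT)

/-- **Gaussian upper bound on the tilted Gibbs weight**: for `ϑ < 1/T`, with `b = 1/T - ϑ`,
`e^{ϑH} e^{-H/T} = e^{-bH} ≤ ∏_i e^{-(bω₂/2) q_i²} ∏_i e^{-(b/2) p_i²}` (`lam, β ≥ 0`). [folklore] -/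
theorem pinnedChain_exp_mul_gibbsDensity_le_prod (hl : 0 ≤ lam) (hβ : 0 ≤ β) (γ : ℝ) (N : ℕ)
    {T ϑ : ℝ} (hT : 0 < T) (hϑ : ϑ < 1 / T) (x : PhaseSpace N) :
    Real.exp (ϑ * (pinnedChain ω₂ lam β γ).hamiltonian N x) * (pinnedChain ω₂ lam β γ).gibbsDensity N T x ≤
      (∏ i, Real.exp (-((1 / T - ϑ) * ω₂ / 2) * x.1 i ^ 2)) *
        ∏ i, Real.exp (-((1 / T - ϑ) / 2) * x.2 i ^ 2) := by
  have hb : 0 ≤ 1 / T - ϑ := (sub_pos.mpr hϑ).le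
  have hle := pinnedChain_harmonic_le_hamiltonian (ω₂ := ω₂) hl hβ γ N x
  have e1 : Real.exp (ϑ * (pinnedChain ω₂ lam β γ).hamiltonian N x) *
      (pinnedChain ω₂ lam β γ).gibbsDensity N T x =
      Real.exp (-((1 / T - ϑ) * (pinnedChain ω₂ lam β γ).hamiltonian N x)) := by
    simp only [OscillatorChain.gibbsDensity, ← Real.exp_add]
    congr 1
    field_simp
    ring
  have e2 : (∏ i, Real.exp (-((1 / T - ϑ) * ω₂ / 2) * x.1 i ^ 2)) *
      ∏ i, Real.exp (-((1 / T - ϑ) / 2) * x.2 i ^ 2) =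
      Real.exp (-((1 / T - ϑ) * ((∑ i, ω₂ * x.1 i ^ 2 / 2) + ∑ i, x.2 i ^ 2 / 2))) := by
    simp only [← Real.exp_sum, ← Real.exp_add]
    congr 1
    simp only [neg_add, mul_add, Finset.mul_sum, ← Finset.sum_neg_distrib]
    congr 1 <;> exact Finset.sum_congr rfl fun i _ => by ring
  rw [e1, e2]
  exact Real.exp_le_exp.mpr (by nlinarith [mul_le_mul_of_nonneg_left hle hb])

/-! ## The one-dimensional factors -/

/-- The dressed one-site weight `e^{-(U(a) + 2w(a))/T}` is integrable (`ω₂, T > 0`, `lam, β ≥ 0`;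
Gaussian domination). [folklore] -/
theorem pinnedChain_integrable_exp_neg_dressedU (hω : 0 < ω₂) (hl : 0 ≤ lam) (hβ : 0 ≤ β) (γ : ℝ)
    {T : ℝ} (hT : 0 < T) :
    Integrable fun a : ℝ =>
      Real.exp (-((pinnedChain ω₂ lam β γ).U a + 2 * (a ^ 2 + 2 * β * a ^ 4)) / T) := by
  have hUc : Continuous (pinnedChain ω₂ lam β γ).U :=
    (pinnedChain_contDiff_U ω₂ lam β γ (n := 0)).continuous
  refine (integrable_exp_neg_mul_sq (b := ω₂ / (2 * T)) (by positivity)).mono' (by fun_prop)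
    (ae_of_all _ fun a => ?_)
  rw [Real.norm_eq_abs, abs_of_pos (Real.exp_pos _)]
  refine Real.exp_le_exp.mpr ?_
  show -(ω₂ * a ^ 2 / 2 + lam * a ^ 4 / 4 + 2 * (a ^ 2 + 2 * β * a ^ 4)) / T ≤ -(ω₂ / (2 * T)) * a ^ 2
  rw [div_le_iff₀ hT]
  have e : -(ω₂ / (2 * T)) * a ^ 2 * T = -(ω₂ * a ^ 2 / 2) := by field_simp
  rw [e]
  have h1 : 0 ≤ lam * a ^ 4 / 4 := by positivity
  have h2 : 0 ≤ 2 * (a ^ 2 + 2 * β * a ^ 4) := by positivity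
  linarith

/-- The kinetic one-site weight `e^{-a²/(2T)}` is integrable (`T > 0`). [folklore] -/
theorem integrable_exp_neg_sq_div (T : ℝ) (hT : 0 < T) :
    Integrable fun a : ℝ => Real.exp (-(a ^ 2 / 2) / T) := by
  have := integrable_exp_neg_mul_sq (b := 1 / (2 * T)) (by positivity)
  refine this.congr (ae_of_all _ fun a => ?_)
  simp only
  congr 1
  field_simp

/-! ## (D1) Exponential-moment growth -/

/-- **(D1) Exponential-moment growth of the Gibbs state.** For the pinned anharmonic chain
(`ω₂ > 0`, `lam, β ≥ 0`, any `γ`), `T > 0` and `ϑ < 1/T` there is `c = c(ω₂, lam, β, T, ϑ)` with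
`∫ e^{ϑ H} dμ_T^N ≤ e^{c N}` for EVERY `N` (ratio of partition functions: Gaussian upper bound after
dropping the nonnegative quartic and coupling terms, separable lower bound
`H ≤ ∑ (p_i²/2 + U(q_i) + 2 q_i² + 4β q_i⁴)`). [folklore] -/
theorem pinnedChain_integral_exp_mul_hamiltonian_gibbsMeasure_le_exp_mul :
    ∀ ω₂ lam β γ : ℝ, 0 < ω₂ → 0 ≤ lam → 0 ≤ β → ∀ T ϑ : ℝ, 0 < T → ϑ < 1 / T →
      ∃ c : ℝ, ∀ N : ℕ,
        ∫ x, Real.exp (ϑ * (pinnedChain ω₂ lam β γ).hamiltonian N x)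
            ∂((pinnedChain ω₂ lam β γ).gibbsMeasure N T) ≤ Real.exp (c * N) := by
  intro ω₂ lam β γ hω hl hβ T ϑ hT hϑ
  have hb : 0 < 1 / T - ϑ := sub_pos.mpr hϑ
  -- the four one-dimensional factors
  have if₁ := pinnedChain_integrable_exp_neg_dressedU hω hl hβ γ hT
  have ig₁ := integrable_exp_neg_sq_div T hT
  have if₂ : Integrable fun a : ℝ => Real.exp (-((1 / T - ϑ) * ω₂ / 2) * a ^ 2) :=
    integrable_exp_neg_mul_sq (by positivity)
  have ig₂ : Integrable fun a : ℝ => Real.exp (-((1 / T - ϑ) / 2) * a ^ 2) :=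
    integrable_exp_neg_mul_sq (by positivity)
  obtain ⟨K₁, hK₁def, hK₁⟩ : ∃ K₁ : ℝ, K₁ =
      (∫ a, Real.exp (-((pinnedChain ω₂ lam β γ).U a + 2 * (a ^ 2 + 2 * β * a ^ 4)) / T)) *
        ∫ a, Real.exp (-(a ^ 2 / 2) / T) ∧ 0 < K₁ :=
    ⟨_, rfl, mul_pos (integral_exp_pos if₁) (integral_exp_pos ig₁)⟩
  obtain ⟨K₂, hK₂def, hK₂⟩ : ∃ K₂ : ℝ, K₂ =
      (∫ a, Real.exp (-((1 / T - ϑ) * ω₂ / 2) * a ^ 2)) *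
        ∫ a, Real.exp (-((1 / T - ϑ) / 2) * a ^ 2) ∧ 0 < K₂ :=
    ⟨_, rfl, mul_pos (integral_exp_pos if₂) (integral_exp_pos ig₂)⟩
  refine ⟨Real.log (K₂ / K₁), fun N => ?_⟩
  set P := pinnedChain ω₂ lam β γ with hP
  have hρi : Integrable (P.gibbsDensity N T) := pinnedChain_integrable_gibbsDensity hω hl hβ γ N hT
  -- denominator
  have hden : K₁ ^ N ≤ ∫ x, P.gibbsDensity N T x := by
    rw [hK₁def, mul_pow, ← integral_phaseSpace_prod_mul_prod]
    refine integral_mono_of_nonneg (ae_of_all _ fun x => ?_) hρi (ae_of_all _ fun x => ?_)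
    · exact mul_nonneg (Finset.prod_nonneg fun i _ => (Real.exp_pos _).le)
        (Finset.prod_nonneg fun i _ => (Real.exp_pos _).le)
    · exact pinnedChain_prod_le_gibbsDensity hβ ω₂ lam γ N hT.le x
  -- numerator
  have hnum : ∫ x, Real.exp (ϑ * P.hamiltonian N x) * P.gibbsDensity N T x ≤ K₂ ^ N := by
    rw [hK₂def, mul_pow, ← integral_phaseSpace_prod_mul_prod]
    refine integral_mono_of_nonneg (ae_of_all _ fun x => ?_)
      (integrable_phaseSpace_prod_mul_prod N if₂ ig₂) (ae_of_all _ fun x => ?_)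
    · exact mul_nonneg (Real.exp_pos _).le (P.gibbsDensity_pos N T x).le
    · exact pinnedChain_exp_mul_gibbsDensity_le_prod hl hβ γ N hT hϑ x
  -- assembling the ratio
  rw [P.integral_gibbsMeasure]
  calc (∫ x, P.gibbsDensity N T x)⁻¹ * ∫ x, Real.exp (ϑ * P.hamiltonian N x) * P.gibbsDensity N T x
      ≤ (K₁ ^ N)⁻¹ * K₂ ^ N :=
        mul_le_mul (inv_anti₀ (pow_pos hK₁ N) hden) hnum
          (integral_nonneg fun x => mul_nonneg (Real.exp_pos _).le (P.gibbsDensity_pos N T x).le)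
          (inv_nonneg.mpr (pow_nonneg hK₁.le N))
    _ = Real.exp (Real.log (K₂ / K₁) * N) := by
        rw [mul_comm (Real.log _), Real.exp_nat_mul, Real.exp_log (div_pos hK₂ hK₁), div_pow,
          div_eq_inv_mul]

/-- **(D1') Chebyshev corollary: the energy rarely exceeds `K N`.** With `c` as in (D1) and
`0 ≤ ϑ < 1/T`: `μ_T^N {x | K N < H(x)} ≤ e^{(c - ϑ K) N}` for all `N` and all `K` (real-valued
form, `μ_T^N` is a probability measure). [folklore] -/
theorem pinnedChain_gibbsExpMomentGrowth :
    ∀ ω₂ lam β γ : ℝ, 0 < ω₂ → 0 ≤ lam → 0 ≤ β → ∀ T ϑ : ℝ, 0 < T → 0 ≤ ϑ → ϑ < 1 / T →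
      ∃ c : ℝ, ∀ (N : ℕ) (K : ℝ),
        (∫ x, Real.exp (ϑ * (pinnedChain ω₂ lam β γ).hamiltonian N x)
            ∂((pinnedChain ω₂ lam β γ).gibbsMeasure N T) ≤ Real.exp (c * N)) ∧
        ((pinnedChain ω₂ lam β γ).gibbsMeasure N T
            {x | K * N < (pinnedChain ω₂ lam β γ).hamiltonian N x}).toReal ≤
          Real.exp ((c - ϑ * K) * N) ∧
        (pinnedChain ω₂ lam β γ).gibbsMeasure N T
            {x | K * N < (pinnedChain ω₂ lam β γ).hamiltonian N x} ≤
          ENNReal.ofReal (Real.exp ((c - ϑ * K) * N)) := by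
  intro ω₂ lam β γ hω hl hβ T ϑ hT hϑ0 hϑ
  obtain ⟨c, hc⟩ :=
    pinnedChain_integral_exp_mul_hamiltonian_gibbsMeasure_le_exp_mul ω₂ lam β γ hω hl hβ T ϑ hT hϑ
  refine ⟨c, fun N K => ?_⟩
  set P := pinnedChain ω₂ lam β γ with hP
  set μ := P.gibbsMeasure N T with hμ
  haveI : IsProbabilityMeasure μ := pinnedChain_isProbabilityMeasure_gibbsMeasure hω hl hβ γ N hT
  have hint : Integrable (fun x => Real.exp (ϑ * P.hamiltonian N x)) μ :=
    pinnedChain_integrable_exp_mul_hamiltonian_gibbsMeasure hω hl hβ γ N hT hϑ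
  have hsub : {x | K * N < P.hamiltonian N x} ⊆
      {x | Real.exp (ϑ * (K * N)) ≤ Real.exp (ϑ * P.hamiltonian N x)} := fun x hx =>
    Real.exp_le_exp.mpr (mul_le_mul_of_nonneg_left (le_of_lt (by exact hx)) hϑ0)
  have hmarkov := mul_meas_ge_le_integral_of_nonneg (μ := μ)
    (ae_of_all _ fun x => (Real.exp_pos (ϑ * P.hamiltonian N x)).le) hint (Real.exp (ϑ * (K * N)))
  have hreal : (μ {x | K * N < P.hamiltonian N x}).toReal ≤ Real.exp ((c - ϑ * K) * N) := by
    have h1 : (μ {x | K * N < P.hamiltonian N x}).toReal ≤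
        μ.real {x | Real.exp (ϑ * (K * N)) ≤ Real.exp (ϑ * P.hamiltonian N x)} :=
      ENNReal.toReal_mono (measure_ne_top μ _) (measure_mono hsub)
    have h2 : Real.exp (ϑ * (K * N)) *
        μ.real {x | Real.exp (ϑ * (K * N)) ≤ Real.exp (ϑ * P.hamiltonian N x)} ≤
        Real.exp (c * N) := hmarkov.trans (hc N)
    have h3 : μ.real {x | Real.exp (ϑ * (K * N)) ≤ Real.exp (ϑ * P.hamiltonian N x)} ≤
        Real.exp ((c - ϑ * K) * N) := by
      rw [← le_div_iff₀' (Real.exp_pos _)] at h2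
      rwa [show (c - ϑ * K) * N = c * N - ϑ * (K * N) by ring, Real.exp_sub]
    exact h1.trans h3
  refine ⟨hc N, hreal, ?_⟩
  rw [← ENNReal.ofReal_toReal (measure_ne_top μ _)]
  exact ENNReal.ofReal_le_ofReal hreal

end Summit.AtomisticToContinuum.FouriersLaw.Theorems.NonBallistic

end
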